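import Summits.BirchSwinnertonDyer.BirchSwinnertonDyer.Theorems.ByReductionTypeAtTwoGoodOrdTowerControlLayerEP
import HarnessLib

set_option linter.dupNamespace false -- `…BirchSwinnertonDyer.BirchSwinnertonDyer…` is the cell's nested layout (D-0017)
set_option autoImplicit false

/-!
# Greenberg LNM 1716 Lemma 3.4 at the layers `n ≥ 1`, brick 1: the EXACT Euler–Poincaré count over an open subgroup
# (`#M_Γ^H(M) = #M^{[Γ:H]}`, so Tate's formula over `H` has the exact constant `#(𝒪_F / #M^{[Γ:H]})`)

Seat `bsd-inputs-k4-p1` (gen 6; LADDER-BSD D-0154 KEY (147)(f) «prove the printed input», row 1 K4 INPUTS; Greenberg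
1999), `--supports stmt-BirchSwinnertonDyer-20309`. THEOREMS ONLY (no definition, no named fact, no `sorry`).

Purpose: the tree carries Greenberg's Lemma 3.4 over `ℚ` at EVERY layer as the NAMED FACT
`Greenberg1999.lemma34_natCard_localTowerKerPrimary_eq_rat` (`#𝒦_{v,n}[p^∞] = (p^{ord_p #Ẽ(𝔽_p)})²`); gen 5 proved the layer
`n = 0` (`InputsGreenbergLemma34.lemma34_rat_zero`), cell bsd-2adic proved the BOUNDEDNESS at every layer
(`GoodOrdTower.exists_natCard_localTowerKerPrimary_le`). The exact count at the layers needs every inequality of the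
bsd-2adic chain as an equality. Cell bsd-2adic's BRICK F (`GoodOrdTower.natCard_one_restrict_le_of_localEP`) is Tate's
formula over an open `H ≤ Γ_F` by Shapiro with the induced module's order only BOUNDED, `p^m = #M_Γ^H(M) ≤ #M^{[Γ:H]}`
(an induced function is determined by its values at coset representatives). Here the evaluation at the inverses of a
system of representatives is shown to be a BIJECTION (Serre I §2.5: `M_G^H(A) ≅ ∏_{G/H} A` as groups), giving the exact
constant:

* `natCard_coindModule_eq_pow` — `G` compact, `S ≤ G` open, `A` finite discrete: `#M_G^S(A) = #A^{[G:S]}`.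
* `natCard_one_restrict_eq_of_localEP` — `F` a non-archimedean local field of characteristic `0` with Tate's formula
  (`localEulerPoincareCharacteristic F`, a tree THEOREM: `localEulerPoincareCharacteristic_holds`), `H ≤ Γ_F` open normal,
  `M` finite discrete `p`-primary: `#H¹(H, M) = #M^H · #H²(H, M) · #(𝒪_F / p^m)` with `p^m = #M^{[Γ_F:H]}` EXACTLY.

HONEST FRAMING: group-cohomology bookkeeping (TOOL theorems); closes nothing; no summit statement is proved; BSD is not
proved by any of this.

References: [SerreGaloisCohomology1997] I §2.5 (induced modules, Prop. 10); [MilneADT2006] I Thm. 2.8.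
-/

noncomputable section

open scoped Classical

universe u

namespace Summit.BirchSwinnertonDyer.BirchSwinnertonDyer.Theorems.InputsGreenbergLemma34Layer

open CategoryTheory Field Literature.NumberTheory.GaloisRepresentations _root_.TopRep _root_.ContRepresentation
  _root_.ContinuousCohomology Literature.NumberTheory.GaloisRepresentations.DiscreteGaloisModule ValuativeRel
  Summit.BirchSwinnertonDyer.BirchSwinnertonDyer.Theorems.GoodOrdTower

/-- **`#M_G^S(A) = #A^{[G:S]}`** for a compact group `G`, an open subgroup `S` and a finite discrete `S`-module `A`: the map
`a* ↦ (c ↦ a*(c̃⁻¹))` (`c̃ = c.out`, `c ∈ G/S`, so that the `c̃⁻¹` represent the right cosets `S x`) is a bijection from the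
induced module onto the functions `G/S → A`; its inverse sends `v` to `x ↦ s_x · v(c_x)` with `c_x = x⁻¹ S` and
`s_x = x c̃_x ∈ S`, continuous because `G/S` is discrete. [cite: SerreGaloisCohomology1997, I §2.5] -/
theorem natCard_coindModule_eq_pow {G : Type u} [Group G] [TopologicalSpace G] [IsTopologicalGroup G] [CompactSpace G]
    (S : Subgroup G) (hSo : IsOpen (S : Set G))
    {A : Type u} [AddCommGroup A] [TopologicalSpace A] [DiscreteTopology A] [Finite A]
    (σ : ContinuousRep S ℤ A) :
    Nat.card (coindModule σ) = Nat.card A ^ S.index := by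
  haveI : DiscreteTopology (G ⧸ S) := QuotientGroup.discreteTopology hSo
  haveI : Finite (G ⧸ S) := finite_of_compact_of_discrete
  -- the representative data: `c_x = x⁻¹ S`, `s_x = x · c̃_x ∈ S`, `x = s_x c̃_x⁻¹`
  have hsS : ∀ x : G, x * (QuotientGroup.mk x⁻¹ : G ⧸ S).out ∈ S := fun x ↦ by
    have hc : ((QuotientGroup.mk x⁻¹ : G ⧸ S).out)⁻¹ * x⁻¹ ∈ S := by
      rw [← QuotientGroup.eq, QuotientGroup.out_eq']
    have h := S.inv_mem hc
    rwa [mul_inv_rev, inv_inv, inv_inv] at h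
  let sx : G → S := fun x ↦ ⟨x * (QuotientGroup.mk x⁻¹ : G ⧸ S).out, hsS x⟩
  have hsx : ∀ x : G, ((sx x : S) : G) = x * (QuotientGroup.mk x⁻¹ : G ⧸ S).out := fun _ ↦ rfl
  -- two points in the same right coset: `y x⁻¹ ∈ S ⇒ c_y = c_x` and `s_y = (y x⁻¹) s_x`
  have hmk : ∀ x y : G, y * x⁻¹ ∈ S → (QuotientGroup.mk y⁻¹ : G ⧸ S) = QuotientGroup.mk x⁻¹ := fun x y h ↦ by
    rw [QuotientGroup.eq, inv_inv]; exact h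
  have hsxy : ∀ (x y : G) (h : y * x⁻¹ ∈ S), sx y = ⟨y * x⁻¹, h⟩ * sx x := fun x y h ↦ by
    refine Subtype.ext ?_
    rw [Subgroup.coe_mul, hsx, hsx, hmk x y h, ← mul_assoc, inv_mul_cancel_right]
  let Φ : coindModule σ → (G ⧸ S → A) := fun f c ↦ (f : C(G, A)) c.out⁻¹
  have hΦinj : Function.Injective Φ := by
    intro f f' hff'
    refine Subtype.ext (ContinuousMap.ext fun x ↦ ?_)
    have hx : x = (x * (QuotientGroup.mk x⁻¹ : G ⧸ S).out) * ((QuotientGroup.mk x⁻¹ : G ⧸ S).out)⁻¹ := by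
      rw [mul_inv_cancel_right]
    have key : ∀ g : coindModule σ, (g : C(G, A)) x =
        σ (sx x) ((g : C(G, A)) ((QuotientGroup.mk x⁻¹ : G ⧸ S).out)⁻¹) := fun g ↦ by
      have h := (mem_coind_iff σ (g : C(G, A))).1 g.2 (sx x) ((QuotientGroup.mk x⁻¹ : G ⧸ S).out)⁻¹
      rw [hsx, ← hx] at h
      exact h
    rw [key f, key f']
    exact congrArg _ (congrFun hff' (QuotientGroup.mk x⁻¹))
  have hΦsurj : Function.Surjective Φ := by
    intro v
    -- the candidate function `x ↦ s_x · v(c_x)` and its local constancy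
    let f₀ : G → A := fun x ↦ σ (sx x) (v (QuotientGroup.mk x⁻¹))
    have hf₀eq : ∀ x : G, f₀ x = σ (sx x) (v (QuotientGroup.mk x⁻¹)) := fun _ ↦ rfl
    have hshift : ∀ (x y : G) (h : y * x⁻¹ ∈ S), f₀ y = σ ⟨y * x⁻¹, h⟩ (f₀ x) := fun x y h ↦ by
      rw [hf₀eq, hf₀eq, hsxy x y h, map_mul, hmk x y h]
      rfl
    have hf₀ : Continuous f₀ := by
      refine ((IsLocallyConstant.iff_eventually_eq f₀).2 fun x ↦ ?_).continuous
      -- the stabiliser of `f₀ x` in `S` is open, and so is its translate `{y : y x⁻¹ ∈ Stab}`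
      let T : Set S := (fun s : S ↦ σ s (f₀ x)) ⁻¹' {f₀ x}
      have hTo : IsOpen T := (isOpen_discrete _).preimage (σ.continuous_apply_left (f₀ x))
      have hT'o : IsOpen (Subtype.val '' T : Set G) := hSo.isOpenMap_subtype_val _ hTo
      let U : Set G := (fun y : G ↦ y * x⁻¹) ⁻¹' (Subtype.val '' T)
      have hUo : IsOpen U := hT'o.preimage (continuous_mul_const x⁻¹)
      have hxU : x ∈ U := by
        refine ⟨1, ?_, ?_⟩
        · change σ 1 (f₀ x) = f₀ x
          rw [map_one]; rfl
        · change ((1 : S) : G) = x * x⁻¹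
          rw [mul_inv_cancel]; rfl
      refine Filter.eventually_of_mem (hUo.mem_nhds hxU) fun y hy ↦ ?_
      obtain ⟨s, hsT, hs⟩ := hy
      change (s : G) = y * x⁻¹ at hs
      have hyx : y * x⁻¹ ∈ S := by rw [← hs]; exact s.2
      have hs' : s = ⟨y * x⁻¹, hyx⟩ := Subtype.ext hs
      rw [hshift x y hyx, ← hs']
      exact hsT
    let f : C(G, A) := ⟨f₀, hf₀⟩
    have hfmem : f ∈ coindModule σ := by
      rw [mem_coind_iff]
      intro s x
      change f₀ ((s : G) * x) = σ s (f₀ x)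
      have h : (s : G) * x * x⁻¹ ∈ S := by rw [mul_inv_cancel_right]; exact s.2
      rw [hshift x ((s : G) * x) h]
      congr 1
      exact congrArg σ (Subtype.ext (by change (s : G) * x * x⁻¹ = s; rw [mul_inv_cancel_right]))
    refine ⟨⟨f, hfmem⟩, funext fun c ↦ ?_⟩
    change f₀ c.out⁻¹ = v c
    have hc : (QuotientGroup.mk (c.out⁻¹)⁻¹ : G ⧸ S) = c := by rw [inv_inv, QuotientGroup.out_eq']
    have h1 : sx c.out⁻¹ = 1 := Subtype.ext (by rw [hsx, hc, inv_mul_cancel]; rfl)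
    rw [hf₀eq, h1, map_one, hc]
    rfl
  rw [Nat.card_eq_of_bijective Φ ⟨hΦinj, hΦsurj⟩, Nat.card_fun, Subgroup.index]

set_option maxHeartbeats 800000 in
/-- **Tate's Euler–Poincaré formula over an open subgroup with the EXACT constant.** `F` a non-archimedean local field of
characteristic `0` satisfying `localEulerPoincareCharacteristic F` (a tree theorem), `H ≤ Γ_F` open and normal, `M` a finite
discrete `p`-primary `Γ_F`-module: `H¹(H, M)`, `H²(H, M)` are finite and
`#H¹(H, M) = #M^H · #H²(H, M) · #(𝒪_F / p^m)` where `p^m = #M^{[Γ_F : H]}` (`= #M_Γ^H(M)`,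
`natCard_coindModule_eq_pow`). Same proof as cell bsd-2adic's `natCard_one_restrict_le_of_localEP` (Tate for the induced
module, Shapiro in degrees `0,1,2`) with the bound replaced by the exact order.
[cite: MilneADT2006, I §2 Thm. 2.8] [cite: SerreGaloisCohomology1997, I §2.5 Prop. 10] -/
theorem natCard_one_restrict_eq_of_localEP (F : Type u) [Field F] [ValuativeRel F] [TopologicalSpace F]
    [IsNonarchimedeanLocalField F] [CharZero F] (hEP : localEulerPoincareCharacteristic F)
    (H : Subgroup (absoluteGaloisGroup F)) [H.Normal] (hHo : IsOpen (H : Set (absoluteGaloisGroup F)))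
    {M : Type u} [AddCommGroup M] [TopologicalSpace M] [DiscreteTopology M] [Finite M]
    (ρ : ContinuousRep (absoluteGaloisGroup F) ℤ M) {p : ℕ} [Fact p.Prime] (hM : IsPrimaryTorsion p M) :
    Finite (continuousCohomology 1 (ρ.restrict (subgroupIncl H)).toTopRep) ∧
      Finite (continuousCohomology 2 (ρ.restrict (subgroupIncl H)).toTopRep) ∧
      ∃ m : ℕ, p ^ m = Nat.card M ^ H.index ∧
        Nat.card (continuousCohomology 1 (ρ.restrict (subgroupIncl H)).toTopRep) =
          Nat.card (ρ.restrict (subgroupIncl H)).toTopRep.ρ.invariants *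
            Nat.card (continuousCohomology 2 (ρ.restrict (subgroupIncl H)).toTopRep) *
            Nat.card (𝒪[F] ⧸ Ideal.span {((p ^ m : ℕ) : 𝒪[F])}) := by
  -- adapted from Summits/.../Theorems/ByReductionTypeAtTwoGoodOrdTowerControlLayerEP.lean (cell bsd-2adic, BRICK F)
  let Γ := absoluteGaloisGroup F
  haveI : CompactSpace Γ := absoluteGaloisGroup_compactSpace F
  haveI hHc : IsClosed (H : Set Γ) := Subgroup.isClosed_of_isOpen _ hHo
  haveI : DiscreteTopology (Γ ⧸ H) := QuotientGroup.discreteTopology hHo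
  haveI : Finite (Γ ⧸ H) := finite_of_compact_of_discrete
  haveI : CompactSpace H := compactSpace_of_isClosed_subgroup (S := H)
  let σ : ContinuousRep H ℤ M := ρ.restrict (subgroupIncl H)
  haveI : DiscreteTopology (coindModule σ) := discreteTopology_coind σ
  haveI : Finite (coindModule σ) := finite_coindModule F H ρ
  -- Tate's formula for the induced module
  obtain ⟨hf1, hf2, hEPX⟩ := hEP (coindRep σ)
  haveI := hf1
  haveI := hf2
  -- Shapiro in degrees `0`, `1`, `2`
  have e1 := shapiroEquiv H ρ 0
  have e2 := shapiroEquiv H ρ 1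
  have e0 := invariantsCoindEquiv H ρ
  have hf1' : Finite (continuousCohomology 1 σ.toTopRep) := Finite.of_equiv _ e1
  have hf2' : Finite (continuousCohomology 2 σ.toTopRep) := Finite.of_equiv _ e2
  refine ⟨hf1', hf2', ?_⟩
  -- `#M_Γ^H(M) = p^m = #M^{[Γ:H]}`
  obtain ⟨m, hm⟩ := exists_card_eq_prime_pow (p := p) (coindModule σ) (isPrimaryTorsion_coind σ hM)
  have heq : Nat.card (coindModule σ) = Nat.card M ^ H.index := natCard_coindModule_eq_pow H hHo σ
  refine ⟨m, hm ▸ heq, ?_⟩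
  rw [← Nat.card_congr e1, ← Nat.card_congr e2, ← Nat.card_congr e0, ← hEPX, hm]

end Summit.BirchSwinnertonDyer.BirchSwinnertonDyer.Theorems.InputsGreenbergLemma34Layer

end
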